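import Summits.QuantumFields.BalabanUV.T4Continuum.Support.VariationalCovariantInterpolant
import Summits.QuantumFields.BalabanUV.T4Continuum.Support.VariationalCovariantH2
import Summits.QuantumFields.BalabanUV.T4Continuum.Support.VariationalCovariantScalarPair

/-!
# T⁴ programme, spine node NE2 (U1a), lane P2 — BRIDGE between leaf ONE⁺'s regularity functional and leaf REG⁺'s H²-functional:
# `VariationalCovariantInterpolant.hess = VariationalCovariantH2.rho` (the same full forward covariant Hessian), and the physical reading of
# the owner's covariant lattice H²-estimate in the capstone's letters

NE2 formalisation swarm `b2b-balaban-t4-ne2-formalise-*`, leaf 01 GEN 2 (`prover-b2b-balaban-t4-ne2-formalise-leaf-01-g2-0`), SUPPLIER SEAT for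
leaf ONE⁺ («s5») of the P2 skeleton `t4/skeletons/NE2-t4-ne2-p2.md` v0.8; journal CLAIM l.8374, RESULT l.8788, LANDED l.9335.  Bookkeeping only:
leaf ONE⁺ (`VariationalCovariantOneStepPhys.blockSpin_Q1_le`, p213246) measures the coarse field by `ρ = VariationalCovariantInterpolant.rho n M Rc
= n⁴/n^d·hess`, `hess N R f = Σ_μ Σ_ν dirU N R (D⁺_ν f) μ`; leaf REG⁺'s core (`VariationalCovariantH2.h2_estimate`, p212759, road owner
t4-ne2-p2-g10) bounds `VariationalCovariantH2.rho N R f = Σ_ν Σ_μ nsq ((D_ν·D_μ) f)`.  These are THE SAME functional (`hess_eq_rho`: the matrix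
`Dm` acts as `cD`, `Dm_mulVec`/`nsq_Dm_mulVec`), so `h2_estimate` reads, in the capstone's physical letters (`Sc`, `qW` of
`VariationalCovariantScalarPair`), as

  `ρ(f) ≤ 2·(n⁴/n^d)·Σ|Δ_R f|² + (d·(n²a_f))²·qW f + 2d·(n²a_f)·Sc f`          (`rho_le_h2_phys`)

for unit phases with plaquette defects `≤ a_f` (`n²·a_f ≍ α` = the field strength for the unit-scale-smooth class: k-UNIFORM coefficients).
The REG⁺ LINK proper (the bound of `Σ|Δ_R(H μ)|²` at the constrained minimiser via `VariationalKKT.euler_lagrange`) is the owner's ∕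
leaf-09-g3's and is NOT in this file.

HONEST FRAMING (T4-DAG p. 1).  Rung (B)+1 only — NOT infinite volume, NOT a mass gap, NOT Clay.  NE2 is NOT IN PRINT and NOT proved here;
model level (U(1) phases = DATA); [folklore] bookkeeping; no `def`; no `sorry`; axioms standard.  HONEST DEPENDENCY (cell, verbatim): continuum
YM on T⁴ ⇐ BetaPertH ∧ nine spine estimates (0/9 proved); BetaPertH ⇐ (D1) ∧ (D4) ∧ CAP+tail; G-an2-4 gates asym, D1 and NE2/3/4.
-/

noncomputable section

namespace Summit.QuantumFields.BalabanUV.T4Continuum.VariationalCovariantHessBridge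

open Finset
open scoped Matrix
open Literature.MathematicalPhysics.QuantumFieldTheory.Balaban1983to89
open Literature.MathematicalPhysics.QuantumFieldTheory.Balaban1983to89.B5Prop11Plancherel (Tor fine unitVec)
open Literature.MathematicalPhysics.QuantumFieldTheory.Balaban1983to89.B5Prop11Lower (nsq nsq_nonneg)
open Summit.QuantumFields.BalabanUV.T4Continuum.VariationalCovariantFederbush (cD dirU dirU_nonneg)
open Summit.QuantumFields.BalabanUV.T4Continuum.VariationalCovariantInterpolant (hess rho)
open Summit.QuantumFields.BalabanUV.T4Continuum.VariationalCovariantH2 (Dm Lap plaq dirF Dm_mulVec nsq_Dm_mulVec h2_estimate)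
open Summit.QuantumFields.BalabanUV.T4Continuum.VariationalCovariantScalarPair (Sc qW)

variable {d : ℕ}

/-! ## §1 The two regularity functionals coincide -/

section Lattice

variable (N : Fin d → ℕ) [∀ μ, NeZero (N μ)] (R : Tor N → Fin d → ℂ)

/-- **`hess = rho`**: leaf ONE⁺'s `Σ_μ Σ_ν Σ_y |(D⁺_μ(D⁺_ν f))(y)|²` (functions, `cD`) IS leaf REG⁺'s `Σ_ν Σ_μ nsq ((D_ν·D_μ) f)` (matrices, `Dm`) —
outer index = outer derivative in both. [folklore] -/
theorem hess_eq_rho (f : Tor N → ℂ) : hess N R f = VariationalCovariantH2.rho N R f := by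
  unfold hess VariationalCovariantH2.rho
  refine Finset.sum_congr rfl fun ν _ => Finset.sum_congr rfl fun μ _ => ?_
  have e : Dm N R μ *ᵥ f = fun z => cD N R f z μ := funext fun z => Dm_mulVec N R μ f z
  rw [← Matrix.mulVec_mulVec, e, nsq_Dm_mulVec]

/-- leaf REG⁺'s Dirichlet functional is `Σ_μ dirU`. [folklore] -/
theorem dirF_eq_sum_dirU (f : Tor N → ℂ) : dirF N R f = ∑ μ, dirU N R f μ := by
  unfold dirF
  exact Finset.sum_congr rfl fun μ _ => nsq_Dm_mulVec N R μ f

/-- the owner's covariant lattice H²-estimate, read for `hess`: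
`hess f ≤ 2·Σ|Δ_R f|² + (d·a_f)²·Σ|f|² + 2d·a_f·Σ_μ dirU f μ`. [folklore] -/
theorem hess_le_h2 (hR : ∀ y μ, ‖R y μ‖ = 1) {af : ℝ} (haf0 : 0 ≤ af) (haf : ∀ y μ ν, ‖plaq N R y μ ν‖ ≤ af) (f : Tor N → ℂ) :
    hess N R f ≤ 2 * nsq (Lap N R *ᵥ f) + (d * af) ^ 2 * nsq f + 2 * d * af * ∑ μ, dirU N R f μ := by
  rw [hess_eq_rho, ← dirF_eq_sum_dirU]
  exact h2_estimate N R hR haf0 haf f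

end Lattice

/-! ## §2 Physical units: `ρ = n⁴/n^d·hess` against the capstone's `Sc`, `qW` -/

section Phys

variable (n : ℕ) [NeZero n] (M : Fin d → ℕ) [hM : ∀ μ, NeZero (M μ)]

/-- `ρ` of leaf ONE⁺ is `n⁴/n^d` times leaf REG⁺'s lattice functional. [folklore] -/
theorem rho_eq (Rc : Tor (fine n M) → Fin d → ℂ) (f : Tor (fine n M) → ℂ) :
    rho n M Rc f = (n : ℝ) ^ 4 / (n : ℝ) ^ d * VariationalCovariantH2.rho (fine n M) Rc f := by
  unfold rho
  rw [hess_eq_rho]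

/-- **THE H²-ESTIMATE IN PHYSICAL LETTERS**: for unit phases with plaquette defects `≤ a_f` at level `n`,
`ρ(f) ≤ 2·(n⁴/n^d)·Σ|Δ_R f|² + (d·(n²·a_f))²·qW f + 2d·(n²·a_f)·Sc f` — the coefficients carry `n²·a_f` (≍ the field strength, k-uniform for
the unit-scale-smooth class). [folklore] -/
theorem rho_le_h2_phys {Rc : Tor (fine n M) → Fin d → ℂ} (hR : ∀ y μ, ‖Rc y μ‖ = 1) {af : ℝ} (haf0 : 0 ≤ af)
    (haf : ∀ y μ ν, ‖plaq (fine n M) Rc y μ ν‖ ≤ af) (f : Tor (fine n M) → ℂ) :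
    rho n M Rc f ≤ 2 * ((n : ℝ) ^ 4 / (n : ℝ) ^ d) * nsq (Lap (fine n M) Rc *ᵥ f)
      + (d * ((n : ℝ) ^ 2 * af)) ^ 2 * qW n M f + 2 * d * ((n : ℝ) ^ 2 * af) * Sc n M Rc f := by
  have hn : (0 : ℝ) < (n : ℝ) ^ d := by have := NeZero.ne n; positivity
  have hc : 0 ≤ (n : ℝ) ^ 4 / (n : ℝ) ^ d := by positivity
  have h := mul_le_mul_of_nonneg_left (hess_le_h2 (fine n M) Rc hR haf0 haf f) hc
  have hSc : Sc n M Rc f = (n : ℝ) ^ 2 / (n : ℝ) ^ d * ∑ μ, dirU (fine n M) Rc f μ := rfl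
  have hqW : qW n M f = ((n : ℝ) ^ d)⁻¹ * nsq f := rfl
  have e : (n : ℝ) ^ 4 / (n : ℝ) ^ d * (2 * nsq (Lap (fine n M) Rc *ᵥ f) + (d * af) ^ 2 * nsq f + 2 * d * af * ∑ μ, dirU (fine n M) Rc f μ)
      = 2 * ((n : ℝ) ^ 4 / (n : ℝ) ^ d) * nsq (Lap (fine n M) Rc *ᵥ f)
        + (d * ((n : ℝ) ^ 2 * af)) ^ 2 * qW n M f + 2 * d * ((n : ℝ) ^ 2 * af) * Sc n M Rc f := by
    rw [hSc, hqW]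
    field_simp
  calc rho n M Rc f = (n : ℝ) ^ 4 / (n : ℝ) ^ d * hess (fine n M) Rc f := rfl
    _ ≤ _ := h
    _ = _ := e

end Phys

end Summit.QuantumFields.BalabanUV.T4Continuum.VariationalCovariantHessBridge

end
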